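import Summits.QuantumFields.YangMills.Theorems.LuscherReductionRunningReductionTraceFormula
import Summits.QuantumFields.YangMills.Theorems.FemtoTransferGapGroundState
import Literature.MathematicalPhysics.QuantumFieldTheory.Balaban1983to89.InfiniteVolumeSufficientXII
import Literature.MathematicalPhysics.QuantumFieldTheory.WilsonTorusTransferMatrix
import Summits.QuantumFields.YangMills.Theorems.LuscherReductionTwistedTraceScalingGaugeSlice
import HarnessLib

/-!
# `TwistedTraceScaling` (crux stmt-QuantumFields-20203, route `LuscherReduction`, skeleton «twolattice»):
# negative-side support (R73a) — the bridge from the tree's zero-flux transfer kernel to the Literature's Wilson slice kernel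

HONEST FRAMING: `TwistedTraceScaling` is a femto-rung (R2b1) crux of a CONDITIONAL reduction route; nothing here is a mass-gap or
Clay statement, and this file does NOT refute the crux.  All objects are the tree's (`FemtoTransferGap.transferKernel`, `transferApply`,
`physL2`, `levelValue`, `TT.physTrace(Succ)`, `TraceDoor.traceRatio`) and the Literature's (`wilsonSliceKernel`, `wilsonTorusTransferMatrix`,
`cyclicPartition`, `transferSpectralRadius`, `traceExcess`, `Balaban1983to89.Missing.strongCouplingRadius`).  No proposition and no
definition is introduced (the normalisation constant `c_{β,L} = exp(β Σ_{x,i} 2)` is written out).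

Content (`StrongRoot`).  The tree's zero-flux kernel `K_β(U,V) = e^{−β(S(U)+S(V))/2 + β·tc(U,V)}` on `SU(2)^{edges}` and the
Literature's Wilson slice kernel `W_β(U,V) = ∫ e^{−S_sp(U)/2 − S_tm(U,g,V) − S_sp(V)/2} dg` differ by a gauge average and a constant:
`∫ K_β(U, g·V) dg = c_{β,L} · W_β(U,V)` with `c_{β,L} = e^{β Σ_{x,i} 2}` (`integral_transferKernel_gaugeTransform`; `tc` is symmetric and
`S` gauge invariant).  Consequences by Fubini and the invariance of the configuration measure under gauge transformations:
`c_{β,L} ∫ W_β(U,V) φ(V) dV = ∫ dg (K_β φ)(g⁻¹-twisted)` (`sliceConst_mul_integral_wilsonSliceKernel_mul`), the quadratic-form bound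
`c_{β,L} ⟪φ, 𝕎φ⟫ ≤ ‖A‖ ‖φ‖²` for the tree's transfer operator `A` (`sliceConst_mul_inner_le`), `‖A‖ ≤ λ₀ = levelValue 0` (Jentzsch: the
top eigenvector of the positivity-improving `A` is gauge invariant, so its Rayleigh quotient is a physical one; `norm_le_levelValue_zero`),
and therefore `c_{β,L} · λ₊ ≤ λ₀` for the Literature's spectral radius `λ₊ = transferSpectralRadius su2Rep β L`
(`sliceConst_mul_transferSpectralRadius_le`).  Used by `StrongCouplingTraceBridge` (trace comparison, strong-coupling ratio bound) and
`FalseWithoutBetaGeOneKeepingThreshold` (the crux without `1 ≤ β`, threshold kept, is false).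
-/

set_option autoImplicit false

noncomputable section

open MeasureTheory Filter Topology Real
open Literature.MathematicalPhysics.QuantumFieldTheory hiding SU2
open Literature.MathematicalPhysics.QuantumLattice
open Literature.Analysis.OperatorTheory.YMMatrixModel
open Literature.Analysis.OperatorTheory
open scoped InnerProductSpace BigOperators

namespace Summit.QuantumFields.YangMills.Theorems.TwistedTraceScaling.Negative

open Summit.QuantumFields.YangMills.Theorems.FemtoTransferGap
open Summit.QuantumFields.YangMills.Theorems.FemtoTransferGap.TT
open Summit.QuantumFields.YangMills.Theorems.FemtoTransferGap.PhysL2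

namespace StrongRoot

variable {L : ℕ} [NeZero L]

/-- `S_tm(U, g, V) = Σ 2 − timeCoupling(g·V, U)` for `SU(2)`. [folklore] -/
theorem sliceTemporalAction_eq (U : GaugeConfig 3 L SU2) (g : Site 3 L → SU2) (V : GaugeConfig 3 L SU2) :
    sliceTemporalAction su2Rep U g V =
      (∑ _x : Site 3 L, ∑ _i : Fin 3, (2 : ℝ)) - timeCoupling su2Rep (gaugeTransform g V) U := by
  unfold sliceTemporalAction timeCoupling
  rw [Fintype.sum_prod_type, ← Finset.sum_sub_distrib]
  refine Finset.sum_congr rfl fun x _ => ?_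
  rw [← Finset.sum_sub_distrib]
  refine Finset.sum_congr rfl fun i _ => ?_
  simp only [gaugeTransform, Nat.cast_ofNat]

/-- **Kernel identity**: averaging the tree's kernel over the gauge group acting on one slot gives the Wilson slice kernel up to the
constant `c_{β,L}`: `∫ K_β(U, g·V) dg = c_{β,L} · W_β(U, V)`. [cite: MontvayMunster1994, §3.2.6 (3.144)] -/
theorem integral_transferKernel_gaugeTransform (β : ℝ) (U V : GaugeConfig 3 L SU2) :
    ∫ g, transferKernel su2Rep β U (gaugeTransform g V) ∂(gaugeMeasure L) =
      Real.exp (β * ∑ _x : Site 3 L, ∑ _i : Fin 3, (2 : ℝ)) * wilsonSliceKernel su2Rep β U V := by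
  have hK : ∀ g : Site 3 L → SU2, transferKernel su2Rep β U (gaugeTransform g V) =
      Real.exp (-(β / 2) * (wilsonAction su2Rep U + wilsonAction su2Rep V)) *
        Real.exp (β * timeCoupling su2Rep (gaugeTransform g V) U) := fun g => by
    unfold transferKernel
    rw [wilsonAction_gaugeTransform, timeCoupling_fundamentalRep_symm, ← Real.exp_add]
    congr 1; ring
  have hE : ∀ g : Site 3 L → SU2, Real.exp (-(β * sliceTemporalAction su2Rep U g V)) =
      Real.exp (-(β * ∑ _x : Site 3 L, ∑ _i : Fin 3, (2 : ℝ))) *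
        Real.exp (β * timeCoupling su2Rep (gaugeTransform g V) U) := fun g => by
    rw [sliceTemporalAction_eq, ← Real.exp_add]
    congr 1; ring
  unfold wilsonSliceKernel gaugeMeasure
  simp_rw [hK, hE]
  rw [integral_const_mul, integral_const_mul]
  have h1 : Real.exp (β * ∑ _x : Site 3 L, ∑ _i : Fin 3, (2 : ℝ)) *
      Real.exp (-(β * ∑ _x : Site 3 L, ∑ _i : Fin 3, (2 : ℝ))) = 1 := by
    rw [← Real.exp_add, add_neg_cancel, Real.exp_zero]
  have h2 : Real.exp (-(β / 2) * (wilsonAction su2Rep U + wilsonAction su2Rep V)) =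
      Real.exp (-(β * wilsonAction su2Rep U / 2)) * Real.exp (-(β * wilsonAction su2Rep V / 2)) := by
    rw [← Real.exp_add]; congr 1; ring
  rw [h2]
  calc _ = (Real.exp (β * ∑ _x : Site 3 L, ∑ _i : Fin 3, (2 : ℝ)) *
        Real.exp (-(β * ∑ _x : Site 3 L, ∑ _i : Fin 3, (2 : ℝ)))) *
        (Real.exp (-(β * wilsonAction su2Rep U / 2)) * Real.exp (-(β * wilsonAction su2Rep V / 2)) *
          ∫ g, Real.exp (β * timeCoupling su2Rep (gaugeTransform g V) U)
            ∂(Measure.pi fun _ : Site 3 L => haarProbability SU2)) := by rw [h1, one_mul]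
    _ = _ := by ring


/-- `K_β(U, g·V) = K_β(g⁻¹·U, V)`. [folklore] -/
theorem transferKernel_gaugeTransform_right (β : ℝ) (g : Site 3 L → SU2) (U V : GaugeConfig 3 L SU2) :
    transferKernel su2Rep β U (gaugeTransform g V) = transferKernel su2Rep β (gaugeTransform g⁻¹ U) V := by
  conv_lhs => rw [← gaugeTransform_gaugeTransform_inv g U]
  exact transferKernel_gaugeTransform su2Rep β g _ _

/-- Continuity of `su2Rep` and unitarity, packaged. [folklore] -/
theorem su2Rep_mem_unitaryGroup (g : SU2) : su2Rep g ∈ Matrix.unitaryGroup (Fin 2) ℂ :=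
  fundamentalRep_mem_unitaryGroup g

/-- **(K2) Fubini form of the kernel identity**: for `φ ∈ L²` and every `U`,
`c_{β,L} ∫ W_β(U,V) φ(V) dV = ∫ dg ∫ K_β(U, g·V) φ(V) dV`. [folklore] -/
theorem sliceConst_mul_integral_wilsonSliceKernel_mul (β : ℝ) (φ : Lp ℝ 2 (configMeasure SU2 L))
    (U : GaugeConfig 3 L SU2) :
    Real.exp (β * ∑ _x : Site 3 L, ∑ _i : Fin 3, (2 : ℝ)) * ∫ V, wilsonSliceKernel su2Rep β U V * φ V ∂(configMeasure SU2 L) =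
      ∫ g, ∫ V, transferKernel su2Rep β U (gaugeTransform g V) * φ V ∂(configMeasure SU2 L) ∂(gaugeMeasure L) := by
  haveI : SecondCountableTopology SU2 := secondCountableTopology_su2
  haveI := isProbabilityMeasure_gaugeMeasure (L := L)
  obtain ⟨M, -, hM⟩ := exists_norm_transferKernel_le (L := L) β
  have h1 : ∀ V, Real.exp (β * ∑ _x : Site 3 L, ∑ _i : Fin 3, (2 : ℝ)) * (wilsonSliceKernel su2Rep β U V * φ V) =
      ∫ g, transferKernel su2Rep β U (gaugeTransform g V) * φ V ∂(gaugeMeasure L) := fun V => by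
    rw [integral_mul_const, integral_transferKernel_gaugeTransform, mul_assoc]
  rw [← integral_const_mul]
  simp_rw [h1]
  -- Fubini: the integrand `(V, g) ↦ K(U, g·V) φ(V)` is bounded × `L¹`
  have hφ : Integrable (fun V => (φ : GaugeConfig 3 L SU2 → ℝ) V) (configMeasure SU2 L) :=
    (Lp.memLp φ).integrable one_le_two
  have h2 : Integrable (fun z : GaugeConfig 3 L SU2 × (Site 3 L → SU2) => (φ : GaugeConfig 3 L SU2 → ℝ) z.1 * (1 : ℝ))
      ((configMeasure SU2 L).prod (gaugeMeasure L)) := hφ.mul_prod (integrable_const 1)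
  have hKm : Measurable fun z : GaugeConfig 3 L SU2 × (Site 3 L → SU2) =>
      transferKernel su2Rep β U (gaugeTransform z.2 z.1) :=
    (continuous_transferKernel_right β U).measurable.comp TwoLattice.Avg.measurable_gaugeAction
  have h3 : Integrable (fun z : GaugeConfig 3 L SU2 × (Site 3 L → SU2) =>
      transferKernel su2Rep β U (gaugeTransform z.2 z.1) * ((φ : GaugeConfig 3 L SU2 → ℝ) z.1 * (1 : ℝ)))
      ((configMeasure SU2 L).prod (gaugeMeasure L)) :=
    h2.bdd_mul hKm.aestronglyMeasurable (Eventually.of_forall fun z => hM U _)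
  have hint : Integrable (Function.uncurry fun (V : GaugeConfig 3 L SU2) (g : Site 3 L → SU2) =>
      transferKernel su2Rep β U (gaugeTransform g V) * φ V) ((configMeasure SU2 L).prod (gaugeMeasure L)) := by
    refine h3.congr (Eventually.of_forall fun z => ?_)
    simp only [Function.uncurry, mul_one]
  exact integral_integral_swap hint

/-- **(P2) The quadratic form of Lüscher's transfer matrix against the tree's operator**: for the positivity-improving package `A`
of `K_β` and every `φ ∈ L²`, `c_{β,L} ⟪φ, 𝕎 φ⟫ ≤ ‖A‖ ‖φ‖²`. [folklore] -/
theorem sliceConst_mul_inner_le (β : ℝ) {A : Lp ℝ 2 (configMeasure SU2 L) →L[ℝ] Lp ℝ 2 (configMeasure SU2 L)}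
    (hA : ∀ v : Lp ℝ 2 (configMeasure SU2 L),
      (A v : GaugeConfig 3 L SU2 → ℝ) =ᵐ[configMeasure SU2 L] fun U => ∫ V, transferKernel su2Rep β U V * v V ∂configMeasure SU2 L)
    (φ : Lp ℝ 2 (configMeasure SU2 L)) :
    Real.exp (β * ∑ _x : Site 3 L, ∑ _i : Fin 3, (2 : ℝ)) * ⟪φ, wilsonTorusTransferMatrix su2Rep β L φ⟫_ℝ ≤ ‖A‖ * ‖φ‖ ^ 2 := by
  haveI : SecondCountableTopology SU2 := secondCountableTopology_su2
  haveI := isProbabilityMeasure_gaugeMeasure (L := L)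
  obtain ⟨M, hM0, hM⟩ := exists_norm_transferKernel_le (L := L) β
  have hφm : Measurable (φ : GaugeConfig 3 L SU2 → ℝ) := (Lp.stronglyMeasurable φ).measurable
  set F : GaugeConfig 3 L SU2 → ℝ := transferApply β (φ : GaugeConfig 3 L SU2 → ℝ) with hFdef
  have hFm : Measurable F := measurable_transferApply β hφm
  have hFb : ∀ X, |F X| ≤ M * Real.sqrt ((configMeasure SU2 L).real Set.univ) * ‖φ‖ := fun X => by
    rw [hFdef, transferApply_apply]; exact abs_integral_kernel_mul_le hM hM0 φ X
  -- Step 1: `⟪φ, 𝕎φ⟫` as a double integral, and the kernel identity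
  have hinner : ⟪φ, wilsonTorusTransferMatrix su2Rep β L φ⟫_ℝ =
      ∫ U, φ U * ∫ V, wilsonSliceKernel su2Rep β U V * φ V ∂(configMeasure SU2 L) ∂(configMeasure SU2 L) :=
    inner_wilsonTorusTransferMatrix_eq_integral β L continuous_su2Rep φ φ
  have hstep : ∀ U, Real.exp (β * ∑ _x : Site 3 L, ∑ _i : Fin 3, (2 : ℝ)) * ∫ V, wilsonSliceKernel su2Rep β U V * φ V ∂(configMeasure SU2 L) =
      ∫ g, F (gaugeTransform g⁻¹ U) ∂(gaugeMeasure L) := fun U => by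
    rw [sliceConst_mul_integral_wilsonSliceKernel_mul]
    refine integral_congr_ae (Eventually.of_forall fun g => ?_)
    simp only [hFdef, transferApply_apply, transferKernel_gaugeTransform_right]
  have hlhs : Real.exp (β * ∑ _x : Site 3 L, ∑ _i : Fin 3, (2 : ℝ)) * ⟪φ, wilsonTorusTransferMatrix su2Rep β L φ⟫_ℝ =
      ∫ U, ∫ g, φ U * F (gaugeTransform g⁻¹ U) ∂(gaugeMeasure L) ∂(configMeasure SU2 L) := by
    rw [hinner, ← integral_const_mul]
    refine integral_congr_ae (Eventually.of_forall fun U => ?_)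
    simp only
    rw [mul_left_comm, hstep, integral_const_mul]
  -- Step 2: Fubini
  have hφi : Integrable (fun U => (φ : GaugeConfig 3 L SU2 → ℝ) U) (configMeasure SU2 L) :=
    (Lp.memLp φ).integrable one_le_two
  have h2 : Integrable (fun z : GaugeConfig 3 L SU2 × (Site 3 L → SU2) => (φ : GaugeConfig 3 L SU2 → ℝ) z.1 * (1 : ℝ))
      ((configMeasure SU2 L).prod (gaugeMeasure L)) := hφi.mul_prod (integrable_const 1)
  have hGm : Measurable fun z : GaugeConfig 3 L SU2 × (Site 3 L → SU2) => F (gaugeTransform z.2⁻¹ z.1) :=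
    hFm.comp TwoLattice.Avg.measurable_gaugeAction_inv
  have h3 : Integrable (fun z : GaugeConfig 3 L SU2 × (Site 3 L → SU2) =>
      F (gaugeTransform z.2⁻¹ z.1) * ((φ : GaugeConfig 3 L SU2 → ℝ) z.1 * (1 : ℝ))) ((configMeasure SU2 L).prod (gaugeMeasure L)) :=
    h2.bdd_mul hGm.aestronglyMeasurable (Eventually.of_forall fun z => by rw [Real.norm_eq_abs]; exact hFb _)
  have hint : Integrable (Function.uncurry fun (U : GaugeConfig 3 L SU2) (g : Site 3 L → SU2) =>
      φ U * F (gaugeTransform g⁻¹ U)) ((configMeasure SU2 L).prod (gaugeMeasure L)) := by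
    refine h3.congr (Eventually.of_forall fun z => ?_)
    simp only [Function.uncurry]
    ring
  rw [hlhs, integral_integral_swap hint]
  -- Step 3: each `g`-slice is `⟪φ, σ_g (A φ)⟫ ≤ ‖A‖ ‖φ‖²`
  have hslice : ∀ g : Site 3 L → SU2,
      ∫ U, φ U * F (gaugeTransform g⁻¹ U) ∂(configMeasure SU2 L) ≤ ‖A‖ * ‖φ‖ ^ 2 := fun g => by
    have hT := measurePreserving_gaugeTransform_configMeasure (G := SU2) (L := L) g⁻¹
    set σ := Lp.compMeasurePreserving (E := ℝ) (p := 2) (gaugeTransform g⁻¹) hT with hσ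
    have hae : (fun U => F (gaugeTransform g⁻¹ U)) =ᵐ[configMeasure SU2 L] (σ (A φ) : GaugeConfig 3 L SU2 → ℝ) := by
      have h1 := Lp.coeFn_compMeasurePreserving (A φ) hT
      have h2 : (A φ : GaugeConfig 3 L SU2 → ℝ) ∘ gaugeTransform g⁻¹ =ᵐ[configMeasure SU2 L] F ∘ gaugeTransform g⁻¹ :=
        hT.quasiMeasurePreserving.ae_eq_comp (hA φ)
      filter_upwards [h1, h2] with U hU1 hU2
      rw [hU1]
      exact hU2.symm
    have heq : ∫ U, φ U * F (gaugeTransform g⁻¹ U) ∂(configMeasure SU2 L) = ⟪φ, σ (A φ)⟫_ℝ := by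
      rw [inner_eq_integral]
      refine integral_congr_ae ?_
      filter_upwards [hae] with U hU
      rw [hU]
    rw [heq]
    calc ⟪φ, σ (A φ)⟫_ℝ ≤ ‖φ‖ * ‖σ (A φ)‖ := real_inner_le_norm _ _
      _ = ‖φ‖ * ‖A φ‖ := by rw [hσ, Lp.norm_compMeasurePreserving]
      _ ≤ ‖φ‖ * (‖A‖ * ‖φ‖) := mul_le_mul_of_nonneg_left (A.le_opNorm φ) (norm_nonneg _)
      _ = ‖A‖ * ‖φ‖ ^ 2 := by ring
  calc ∫ g, ∫ U, φ U * F (gaugeTransform g⁻¹ U) ∂(configMeasure SU2 L) ∂(gaugeMeasure L)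
      ≤ ∫ _g : Site 3 L → SU2, ‖A‖ * ‖φ‖ ^ 2 ∂(gaugeMeasure L) :=
        integral_mono hint.integral_prod_right (integrable_const _) hslice
    _ = ‖A‖ * ‖φ‖ ^ 2 := by simp

/-- **`‖A‖ ≤ λ₀`**: the norm of the positivity-improving `L²` transfer operator is at most the top min–max value (the Jentzsch vector
is a.e. gauge and twist invariant; its kernel image is a physical test function with Rayleigh quotient `‖A‖`) — the `htop` step of
`PhysL2.secondValue_lt_topValue`, isolated. [cite: ReedSimonIV1978, Thm XIII.43 and Thm XIII.44] -/
theorem norm_le_levelValue_zero (β : ℝ) {A : Lp ℝ 2 (configMeasure SU2 L) →L[ℝ] Lp ℝ 2 (configMeasure SU2 L)}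
    (hA : ∀ v : Lp ℝ 2 (configMeasure SU2 L),
      (A v : GaugeConfig 3 L SU2 → ℝ) =ᵐ[configMeasure SU2 L] fun U => ∫ V, transferKernel su2Rep β U V * v V ∂configMeasure SU2 L)
    (hsa : IsSelfAdjoint A) (hc : IsCompactOperator A) (himp : IsPositivityImproving A) (hne : A ≠ 0) :
    ‖A‖ ≤ levelValue su2Rep L β 0 := by
  obtain ⟨φ, hφ1, hφpos, hAφ, hsimple, -⟩ := himp.exists_spectralGap hsa hc hne
  have hnA : 0 < ‖A‖ := norm_pos_iff.mpr hne
  have hvg : ∀ g : Site 3 L → SU2, (fun U => (φ : GaugeConfig 3 L SU2 → ℝ) (gaugeTransform g U)) =ᵐ[configMeasure SU2 L]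
      (φ : GaugeConfig 3 L SU2 → ℝ) := fun g =>
    ae_comp_eq_of_top hA (measurePreserving_gaugeTransform_configMeasure g) (transferKernel_gaugeTransform su2Rep β g)
      hφ1 hφpos hAφ hsimple
  have hvz : ∀ (k : Fin 3) (z : SU2), z ∈ Subgroup.center SU2 → (fun U => (φ : GaugeConfig 3 L SU2 → ℝ) (twist k z U))
      =ᵐ[configMeasure SU2 L] (φ : GaugeConfig 3 L SU2 → ℝ) := fun k z hz =>
    ae_comp_eq_of_top hA (measurePreserving_twist k z) (transferKernel_twist su2Rep β k hz) hφ1 hφpos hAφ hsimple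
  have hΦ : IsPhys (transferApply β (φ : GaugeConfig 3 L SU2 → ℝ)) := isPhys_transferApply_of_ae_invariant β φ hvg hvz
  set Φ : physSubmodule L := ⟨transferApply β (φ : GaugeConfig 3 L SU2 → ℝ), hΦ⟩ with hΦdef
  have hclass : toL2 Φ = ‖A‖ • φ := by
    rw [← hAφ]
    apply Lp.ext
    filter_upwards [coeFn_toL2 Φ, hA φ] with U h1 h2
    rw [h1, h2]
    rfl
  have hl2 : l2 (Φ : GaugeConfig 3 L SU2 → ℝ) Φ = ‖A‖ ^ 2 := by
    rw [← norm_sq_toL2, hclass, norm_smul, Real.norm_eq_abs, abs_of_pos hnA, hφ1, mul_one]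
  have hq : qform su2Rep β (Φ : GaugeConfig 3 L SU2 → ℝ) Φ = ‖A‖ ^ 3 := by
    rw [← inner_apply_toL2 hA, hclass, map_smul, hAφ, inner_smul_left, inner_smul_right, inner_smul_right,
      real_inner_self_eq_norm_sq, hφ1]
    simp only [RCLike.conj_to_real]
    ring
  have hl2pos : 0 < l2 (Φ : GaugeConfig 3 L SU2 → ℝ) Φ := by rw [hl2]; positivity
  have h := rayleigh_le_topValue su2Rep continuous_su2Rep β hΦ hl2pos
  rw [hq, hl2] at h
  have h3 : ‖A‖ ^ 3 / ‖A‖ ^ 2 = ‖A‖ := by field_simp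
  rw [h3] at h
  rwa [levelValue_zero]

/-- **`c_{β,L} · λ₊(β, L) ≤ λ₀(β, L)`** (`β ≥ 0`): the Literature's principal growth rate of the Wilson slice kernel (all flux sectors), times
the normalisation constant, is at most the tree's zero-flux top value (in fact equal). [folklore] -/
theorem sliceConst_mul_transferSpectralRadius_le {β : ℝ} (hβ : 0 ≤ β) :
    Real.exp (β * ∑ _x : Site 3 L, ∑ _i : Fin 3, (2 : ℝ)) * transferSpectralRadius su2Rep β L ≤ levelValue su2Rep L β 0 := by
  haveI : SecondCountableTopology SU2 := secondCountableTopology_su2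
  obtain ⟨M, hM0, hM⟩ := exists_norm_transferKernel_le (L := L) β
  have hμ : (configMeasure SU2 L) ≠ 0 := IsProbabilityMeasure.ne_zero _
  obtain ⟨A, hA, hsa, hc, himp, hne⟩ := exists_transferOperator (μ := configMeasure SU2 L) (stronglyMeasurable_transferKernel β) hM
    (transferKernel_su2Rep_symm β) (fun U V => transferKernel_pos su2Rep β U V) hμ
  obtain ⟨s, _, b, lam, i₀, hb, -, -, hnorm, -, hrad, -⟩ :=
    exists_spectralData_wilsonTorusTransferMatrix L continuous_su2Rep su2Rep_mem_unitaryGroup hβ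
  have hb1 : ‖b i₀‖ = 1 := b.orthonormal.1 i₀
  have h := sliceConst_mul_inner_le (L := L) β hA (b i₀)
  have key : Real.exp (β * ∑ _x : Site 3 L, ∑ _i : Fin 3, (2 : ℝ)) * lam i₀ ≤ ‖A‖ :=
    calc Real.exp (β * ∑ _x : Site 3 L, ∑ _i : Fin 3, (2 : ℝ)) * lam i₀ = Real.exp (β * ∑ _x : Site 3 L, ∑ _i : Fin 3, (2 : ℝ)) * ⟪b i₀, wilsonTorusTransferMatrix su2Rep β L (b i₀)⟫_ℝ := by
          rw [hb i₀, inner_smul_right, real_inner_self_eq_norm_sq, hb1]; ring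
      _ ≤ ‖A‖ * ‖b i₀‖ ^ 2 := h
      _ = ‖A‖ := by rw [hb1]; ring
  rw [hrad]
  exact key.trans (norm_le_levelValue_zero β hA hsa hc himp hne)

end StrongRoot

end Summit.QuantumFields.YangMills.Theorems.TwistedTraceScaling.Negative

end
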